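import Literature.MathematicalPhysics.QuantumFieldTheory.Balaban1983to89.B9Ineq349Whole
import Literature.MathematicalPhysics.QuantumFieldTheory.Balaban1983to89.B9PinMembersKLevelV1
import Literature.MathematicalPhysics.QuantumFieldTheory.Balaban1983to89.B6Lemma21ParamKLevelTorus
import Literature.MathematicalPhysics.QuantumFieldTheory.Balaban1983to89.B9Eq3132Whole

/-!
# `Balaban1983to89.B9GeoLemma21KLevelV1` — [4] Lemma 2.1 (2.60)–(2.61) and the distance axioms (2.46)∕(2.54) AS THEOREMS on the
# [B9] Sect. A geometry reading `geo9K i` of a member of the k-level V1 torus index (and at def-Y's members `geo9Y x`): the three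
# record-geometry schemas `DistOK`, `LevelGap`, `RowSum261` of `B9Ineq349Whole` DISCHARGED from the torus lineage

T. Bałaban, *Propagators for lattice gauge theories in a background field*, Commun. Math. Phys. **99** (1985) 389–434
[`Balaban1985BackgroundPropagators`, "B9"], p. 399 (3.49) *"using again Lemma 2.1"*; [4] = T. Bałaban, *Propagators and renormalization
transformations for lattice gauge theories. II*, Commun. Math. Phys. **96** (1984) 223–250 [`Balaban1984PropagatorsII`], (2.2) p. 224, (2.46)
p. 231, (2.54) p. 233, (2.59) p. 233, Lemma 2.1 (2.60)–(2.61) p. 234.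

statement-level skeleton of published theorems with citation tags; proofs where landed; nothing here is a claim about the Yang–Mills mass gap

THE POINT.  `B9Ineq349Whole.stmt349Printed_of_thm31_thm32` (the whole printed leaf (3.49), N06 ASSIGNMENT row 25) takes [4] Lemma 2.1 and the
facts of the multiscale distance as FAMILY SCHEMAS over an abstract `geo : I → B9.Geometry` — `DistOK (geo i)` (1 ≦ L, 0 < η, d symmetric with
(2.54)), `LevelGap geo R` ((2.60) in its geometric form d(y, y′) ≧ RM·max(|j − j′| − 1, 0)), `RowSum261 geo` ((2.61) with a generic constant at
every rate under an M-threshold) — and the N06 knit at the record (`Summits/…/BalabanUVNodesN06AtRecord11ObligationsS349`) DISPLAYS them at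
the Stage-3′(Y) geometry of record `B9PinMembersKLevelV1.geo9Y x = B9GeoNormsKLevelV1.geo9K x.toKIdx` (sites = the index bonds of the member,
`dist b b′ = d_T(βb, βb′)` the torus graph distance (2.46) of the carrier blocks, `scale = lvl`, `η = |c_f|⁻¹`, `L = ℓ + 1`, `M = L·M_h`,
`R ≧ 2L²`).  There they are THEOREMS of N03's torus lineage, not obligations.  THIS FILE proves them:

* §1 one member `i : KIdx d ℓ hd hL b₀ b₁`: `geo9K_dist_eq` (the distance is the cast graph distance of `bondT i.D` at the carrier blocks),
  `geo9K_dist_comm`, `geo9K_dist_self`, `geo9K_dist_triangle` ((2.54), `B6Geom246MultiLevelTorus.triangle_refl_nonneg_T`), `geo9K_one_le_L`,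
  `geo9K_eta_pos` (`c_f ≠ 0`), `geo9K_len_pos`, ★ `distOK_geo9K : DistOK (geo9K i)`.
* §2 ★ `levelGap_geo9K : R₀ ≦ 2L² − 1 → LevelGap geo9K R₀` (and `levelGap_geo9K_one`) — (2.60) in GEOMETRIC form from the torus walk form of
  (2.2) `B6Geom246MultiLevelTorus.levelGapT` (every chain of admissible bonds across a level band has ≧ R·M bonds) through
  `B6Geometry.levelGap_dist_real` (`d_T(βb, βb′) ≧ (RM − 1)·max(|j − j′| − 1, 0) ≧ R₀·M·max(…)` for `R₀ ≦ R − 1`, `M ≧ 1`) and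
  `B6Ineq2142KLevelV1.beta_level` (the scale of a bond is the level of its carrier block); `ineq260_geo9K` = the EXPONENTIAL form at every rate.
* §3 ★ `rowSum_geo9K_core` ∕ `rowSum261_geo9K : RowSum261 geo9K` — for every κ > 0: δ₀ := min κ (2∕L), α := ½ (so αδ₀ ≦ κ; rate
  monotonicity), the M-threshold from print's (2.59) read for `(R − 1)·M` with `R − 1 ≧ 1` (`B6Lemma21OneScaleTorus.exists_cond259`), then
  `B6Lemma21ParamKLevelTorus.lemma21Param_kLevelTorusP` BY NAME on the member's torus family `Node00.toKT i` ((2.61) on the blocks with the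
  tree's constant c₁(α), uniform in k, volume, M_h, R), pulled back along `β` with the fibre factor 2(d + 1) (`B6Prop27KLevelV1.card_fiber_beta_le`)
  — the pattern of `Node00.CarriersB6KDischarge.lemma21Param_tower` (which proves the `DagBinding.B6Lemma21Param` shape on `kGeoU`; same sites,
  different schema).  Stated for an ARBITRARY `Fintype (geo9K i).Site` instance (the knit carries it as a binder; `Fintype` is a subsingleton).
* §4 ★ at def-Y's members `x : MemberY d ℓ hd hL b₀ b₁ Mstar` (by `geo9Y x = geo9K x.toKIdx`, `rfl`): `distOK_geo9Y`, `geo9Y_dist_comm` ∕ `_self` ∕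
  `_triangle`, `geo9Y_len_pos`, `levelGap_geo9Y`, `levelGap_geo9Y_one`, `rowSum261_geo9Y` — the displayed binders `D349` ∕ `hgap` ∕ `h261row` of the
  `…ObligationsS349` chain close BY NAME (with any `0 < R₀ ≦ 2L² − 1`, e.g. `R₀ = 1`).

HONEST SCOPE.  Kernel facts of the realised torus geometry of record: (2.46)'s graph distance is a metric; (2.2) ⇒ (2.60) with `R − 1`∕`RM − 1`
(the tree's walk form loses one bond per band, `levelGapT`) — weaker than, and implied by, the literal reading; (2.61) with the tree's GENERIC
constant (`K261`, a function of κ, d, L), NOT print's c₁(α) = 12c₀(½α)^d (refuted as typed for d ≧ 3, `B6Lemma21Counterexample.printed_c1_exceeded`),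
under an M-threshold coming from (2.59) *"RM sufficiently large"*.  Nothing of [B9]'s estimates is asserted; count-neutral supply for the N06 knit;
one finite lattice programme — nothing continuum, nothing about the mass gap.  Cell `pub-ymgap` (HUMAN RULING D-0062), Track A node N06 [B9],
N06-ASSIGNMENT v1 row 25 (bundle F4) completion at the record geometry, seat `pub-ymgap-dag-n06-i` (gen 2), 2026-08-26.
-/

noncomputable section

namespace Literature.MathematicalPhysics.QuantumFieldTheory.Balaban1983to89.B9GeoLemma21KLevelV1

open B6SectAOperatorsV1 (BondIdx)
open B6GlobalChartV1 (PV domT)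
open B6Geom246MultiLevelTorus (geomT bondT connectedT levelGapT triangle_refl_nonneg_T)
open B6Geometry (levelGap_dist_real)
open B6Ineq2142KLevelV1 (lvl β beta_level)
open B6KLevelCensusIndexV1 (KIdx)
open B6Prop27KLevelV1 (card_fiber_beta_le)
open B6Prop22KLevelTorusCensusEta (geoTP)
open B6Lemma21ParamKLevelTorus (lemma21Param_kLevelTorusP)
open B6Lemma21OneScaleTorus (exists_cond259)
open Node00 (toKT)
open B9GeoNormsKLevelV1 (geo9K)
open B9PinMembersKLevelV1 (MemberY geo9Y)
open B9Ineq349Whole (DistOK LevelGap RowSum261)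

variable {d ℓ : ℕ} {hd : 1 ≤ d + 1} {hL : Odd (ℓ + 1) ∧ 1 < ℓ + 1} {b₀ b₁ : ℝ}

/-! ## §1 One member: the distance of `geo9K i` is the torus graph distance of the carrier blocks — a metric; `L ≥ 1`, `η > 0` -/

section OneMember

variable (i : KIdx d ℓ hd hL b₀ b₁)

/-- `1 ≤ M_h` (`M_h ≥ 8` in the V1 index). [cite: Balaban1984PropagatorsII, (2.1) p.224, bookkeeping] -/
theorem one_le_Mh : 1 ≤ i.Mh := le_trans (by norm_num) i.hM8

/-- `1 ≤ P′_μ` (`P′ ≥ 5` in the V1 index). [cite: Balaban1984PropagatorsII, (2.1) p.224, bookkeeping] -/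
theorem one_le_P (μ : Fin (d + 1)) : 1 ≤ i.P' μ := le_trans (by norm_num) (i.hP5 μ)

/-- `1 ≤ k` (`k ≥ 2` in the V1 index). [cite: Balaban1984PropagatorsII, (2.1) p.224, bookkeeping] -/
theorem one_le_k : 1 ≤ i.k := le_trans one_le_two i.hk2

/-- **THE DISTANCE OF THE READING IS (2.46) AT THE CARRIER BLOCKS**: `d(b, b′) = d_T(βb, βb′)`, the graph distance of the admissible bonds of the
torus between the carrier blocks, cast to `ℝ`. [cite: Balaban1984PropagatorsII, (2.45)–(2.46) p.231] -/
theorem geo9K_dist_eq (y y' : (geo9K i).Site) :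
    (geo9K i).dist y y' = (((bondT i.D).dist (β i.hN i.D i.hk y) (β i.hN i.D i.hk y') : ℕ) : ℝ) := rfl

/-- `d(y, y′) = d(y′, y)`. [cite: Balaban1984PropagatorsII, (2.46) p.231 (a graph distance is symmetric)] -/
theorem geo9K_dist_comm (y y' : (geo9K i).Site) : (geo9K i).dist y y' = (geo9K i).dist y' y := by
  rw [geo9K_dist_eq, geo9K_dist_eq, SimpleGraph.dist_comm]

/-- `d(y, y) = 0`. [cite: Balaban1984PropagatorsII, (2.46) p.231, bookkeeping] -/
theorem geo9K_dist_self (y : (geo9K i).Site) : (geo9K i).dist y y = 0 := by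
  rw [geo9K_dist_eq, SimpleGraph.dist_self, Nat.cast_zero]

/-- **(2.54)** `d(y, y″) ≤ d(y, y′) + d(y′, y″)` — p. 233 *"d(y, y″) ≤ d(y, y′) + d(y′, y″) (2.54)"*, for the realised torus distance (the bond graph of
the torus is connected, `connectedT`). [cite: Balaban1984PropagatorsII, (2.54) p.233] -/
theorem geo9K_dist_triangle (a b c : (geo9K i).Site) : (geo9K i).dist a c ≤ (geo9K i).dist a b + (geo9K i).dist b c :=
  (triangle_refl_nonneg_T i.D (one_le_Mh i) (one_le_P i)).1 (β i.hN i.D i.hk a) (β i.hN i.D i.hk b) (β i.hN i.D i.hk c)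

/-- `0 ≤ d(y, y′)`. [cite: Balaban1984PropagatorsII, (2.46) p.231, bookkeeping] -/
theorem geo9K_dist_nonneg' (y y' : (geo9K i).Site) : 0 ≤ (geo9K i).dist y y' := by
  rw [geo9K_dist_eq]; exact Nat.cast_nonneg _

/-- `1 ≤ L = ℓ + 1`. [cite: Balaban1984PropagatorsII, (2.1) p.224, bookkeeping] -/
theorem geo9K_one_le_L : 1 ≤ (geo9K i).L := by
  show (1 : ℝ) ≤ ((ℓ + 1 : ℕ) : ℝ)
  exact_mod_cast Nat.succ_le_succ (Nat.zero_le ℓ)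

/-- `0 < η = |c_f|⁻¹` (`c_f ≠ 0` in the V1 index). [cite: Balaban1984PropagatorsII, (2.1) p.224 («η = L^{−k}»), bookkeeping] -/
theorem geo9K_eta_pos : 0 < (geo9K i).eta := by
  show (0 : ℝ) < |i.cf|⁻¹
  exact inv_pos.mpr (abs_pos.mpr i.hcf)

/-- `0 < L^jη`. [cite: Balaban1985BackgroundPropagators, (3.41) p.397 («Lʲη»), bookkeeping] -/
theorem geo9K_len_pos (y : (geo9K i).Site) : 0 < (geo9K i).len y := by
  show 0 < (geo9K i).L ^ (geo9K i).scale y * (geo9K i).eta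
  exact mul_pos (pow_pos (lt_of_lt_of_le one_pos (geo9K_one_le_L i)) _) (geo9K_eta_pos i)

/-- ★ **`DistOK (geo9K i)`**: the facts of the multiscale distance the abstract carrier cannot see — `1 ≤ L`, `0 < η`, (2.46) symmetric, (2.54) —
HOLD for the reading of record. [cite: Balaban1984PropagatorsII, (2.46) p.231 + (2.54) p.233] -/
theorem distOK_geo9K : DistOK (geo9K i) :=
  ⟨geo9K_one_le_L i, geo9K_eta_pos i, geo9K_dist_comm i, geo9K_dist_triangle i⟩

end OneMember

/-! ## §2 (2.60) in geometric form over the family: `d(y, y′) ≥ R₀·M·max(|j − j′| − 1, 0)` for `R₀ ≤ 2L² − 1` -/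

section LevelGapSec

/-- ★ **[4] (2.60) IN ITS GEOMETRIC FORM ON THE k-LEVEL V1 FAMILY**: for every `R₀ ≤ 2L² − 1` (so `R₀ ≤ R − 1` at every member, `KIdx.hR2`),
`R₀·M·max(|j(y) − j(y′)| − 1, 0) ≤ d(y, y′)` — from the walk form of (2.2) on the torus (`levelGapT`: a chain of admissible bonds across a level
band has at least `R·M` bonds, `M = L·M_h`), `levelGap_dist_real` (`d_T ≥ (RM − 1)·max(…)`) and `beta_level` (`j(b)` = the level of `βb`).
[cite: Balaban1984PropagatorsII, Lemma 2.1 (2.60) p.234, (2.57) p.233, (2.2) p.224] -/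
theorem levelGap_geo9K {R₀ : ℝ} (hR₀ : R₀ ≤ 2 * ((ℓ : ℝ) + 1) ^ 2 - 1) :
    LevelGap (geo9K (d := d) (ℓ := ℓ) (hd := hd) (hL := hL) (b₀ := b₀) (b₁ := b₁)) R₀ := by
  intro i y y'
  have hMh := one_le_Mh i
  have hP := one_le_P i
  have hk1 := one_le_k i
  -- the walk form of (2.2) in its symmetric real form, at the carrier blocks
  have hd : (((i.R * ((ℓ + 1) * i.Mh) - 1 : ℕ) : ℝ)) *
      max (|(((β i.hN i.D i.hk y).1.1 : ℕ) : ℝ) - (((β i.hN i.D i.hk y').1.1 : ℕ) : ℝ)| - 1) 0 ≤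
      (((bondT i.D).dist (β i.hN i.D i.hk y) (β i.hN i.D i.hk y') : ℕ) : ℝ) :=
    levelGap_dist_real (connectedT (D := i.D) hMh hP) (levelGapT i.D) _ _
  rw [beta_level i.hN i.D i.hk hk1 y, beta_level i.hN i.D i.hk hk1 y'] at hd
  show R₀ * ((((ℓ + 1 : ℕ) : ℝ)) * (i.Mh : ℝ)) *
      max (|((lvl i.hN i.D i.hk y : ℕ) : ℝ) - ((lvl i.hN i.D i.hk y' : ℕ) : ℝ)| - 1) 0 ≤
      (((bondT i.D).dist (β i.hN i.D i.hk y) (β i.hN i.D i.hk y') : ℕ) : ℝ)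
  refine le_trans (mul_le_mul_of_nonneg_right ?_ (le_max_right _ _)) hd
  -- `R₀·M ≤ R·M − 1`
  have hR : 2 * ((ℓ : ℝ) + 1) ^ 2 ≤ (i.R : ℝ) := by exact_mod_cast i.hR2
  have hR1 : 1 ≤ i.R := le_trans (Nat.succ_le_of_lt (by positivity)) i.hR2
  have hM1 : (1 : ℝ) ≤ (i.Mh : ℝ) := by exact_mod_cast hMh
  have hℓ0 : (0 : ℝ) ≤ (ℓ : ℝ) := Nat.cast_nonneg ℓ
  have h1 : 1 ≤ i.R * ((ℓ + 1) * i.Mh) :=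
    Nat.one_le_iff_ne_zero.mpr (Nat.mul_ne_zero (by omega) (Nat.mul_ne_zero (by omega) (by omega)))
  rw [Nat.cast_sub h1]
  push_cast
  nlinarith [mul_nonneg (show (0 : ℝ) ≤ (i.R : ℝ) - 1 - R₀ by nlinarith) (show (0 : ℝ) ≤ ((ℓ : ℝ) + 1) * (i.Mh : ℝ) by positivity),
    mul_le_mul hM1 (show (1 : ℝ) ≤ (ℓ : ℝ) + 1 by linarith) zero_le_one (by positivity)]

/-- (2.60) in geometric form with `R₀ = 1`. [cite: Balaban1984PropagatorsII, Lemma 2.1 (2.60) p.234] -/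
theorem levelGap_geo9K_one : LevelGap (geo9K (d := d) (ℓ := ℓ) (hd := hd) (hL := hL) (b₀ := b₀) (b₁ := b₁)) 1 :=
  levelGap_geo9K (by nlinarith [(Nat.cast_nonneg ℓ : (0 : ℝ) ≤ ℓ)])

/-- **(2.60) IN ITS EXPONENTIAL FORM, AT EVERY RATE `ε ≥ 0`**, with `RM` read as `(2L² − 1)·M`: `e^{−εd(y,y′)} ≤ e^{−ε(2L²−1)M·max(|j−j′|−1,0)}` — p. 234
*"e^{−αδ₀d(y,y′)} ≤ e^{−αδ₀RM max{|j−j′|−1,0}} (2.60)"* (the shape `B6Cor28.transfer_of_260` consumes). [cite: Balaban1984PropagatorsII, Lemma 2.1 (2.60) p.234] -/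
theorem ineq260_geo9K (i : KIdx d ℓ hd hL b₀ b₁) {ε : ℝ} (hε : 0 ≤ ε) (y y' : (geo9K i).Site) :
    Real.exp (-(ε * (geo9K i).dist y y')) ≤
      Real.exp (-(ε * (2 * ((ℓ : ℝ) + 1) ^ 2 - 1) * (geo9K i).M *
        max (|((geo9K i).scale y : ℝ) - ((geo9K i).scale y' : ℝ)| - 1) 0)) := by
  have h := levelGap_geo9K (d := d) (ℓ := ℓ) (hd := hd) (hL := hL) (b₀ := b₀) (b₁ := b₁) le_rfl i y y'
  rw [Real.exp_le_exp, neg_le_neg_iff]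
  calc ε * (2 * ((ℓ : ℝ) + 1) ^ 2 - 1) * (geo9K i).M * max (|((geo9K i).scale y : ℝ) - ((geo9K i).scale y' : ℝ)| - 1) 0
      = ε * ((2 * ((ℓ : ℝ) + 1) ^ 2 - 1) * (geo9K i).M * max (|((geo9K i).scale y : ℝ) - ((geo9K i).scale y' : ℝ)| - 1) 0) := by
        ring
    _ ≤ ε * (geo9K i).dist y y' := mul_le_mul_of_nonneg_left h hε

end LevelGapSec

/-! ## §3 (2.61) with a generic constant at every rate under an M-threshold: the row sums over the index bonds -/

section RowSumSec

/-- ★ **[4] (2.61) AT EVERY RATE UNDER AN M-THRESHOLD, ON THE k-LEVEL V1 FAMILY** (core form, the `Fintype` instance on the sites a binder): for every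
`κ > 0` there are `M_L` and `C` such that every member with `M ≥ M_L` has all row sums `Σ_{y′∈𝔅} e^{−κd(y,y′)} ≤ C`.  Proof: δ₀ := min κ (2∕L), α := ½
(αδ₀ ≤ κ); `M_L` from print's (2.59) *"RM sufficiently large"* read for `(R − 1)·M` with `R − 1 ≥ 1` (`exists_cond259`); (2.61) on the blocks of the
member's torus by `lemma21Param_kLevelTorusP` (constant uniform in k, volume, M_h, R); pulled back along `β` with fibres of size ≤ 2(d + 1)
(`card_fiber_beta_le`). [cite: Balaban1984PropagatorsII, Lemma 2.1 (2.61) p.234 + (2.59) p.233] -/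
theorem rowSum_geo9K_core {κ : ℝ} (hκ : 0 < κ) :
    ∃ ML C : ℝ, ∀ (i : KIdx d ℓ hd hL b₀ b₁) [Fintype (geo9K i).Site], ML ≤ (geo9K i).M →
      ∀ y : (geo9K i).Site, ∑ y', Real.exp (-(κ * (geo9K i).dist y y')) ≤ C := by
  classical
  have hℓ1 : 1 ≤ ℓ := by have := hL.2; omega
  have hL0 : (0 : ℝ) < (ℓ : ℝ) + 1 := by positivity
  set δ₀ : ℝ := min κ (2 / ((ℓ : ℝ) + 1)) with hδ₀_def
  have hδ₀ : 0 < δ₀ := lt_min hκ (div_pos two_pos hL0)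
  have hδL : δ₀ ≤ 2 / ((ℓ : ℝ) + 1) := min_le_right _ _
  have hδκ : δ₀ ≤ κ := min_le_left _ _
  have hα0 : (0 : ℝ) < 1 / 2 := by norm_num
  have hα1 : (1 / 2 : ℝ) < 1 := by norm_num
  have hαδ : 0 < 1 / 2 * δ₀ := by positivity
  obtain ⟨c₁, -, h21⟩ := lemma21Param_kLevelTorusP d ℓ hℓ1 hδ₀ hδL
  obtain ⟨R₁, hR₁⟩ := exists_cond259 (d + 1) hαδ
  refine ⟨(R₁ : ℝ), 2 * ((d : ℝ) + 1) * c₁ (1 / 2), fun i inst hM y => ?_⟩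
  -- `Fintype` is a subsingleton: w.l.o.g. the instance on the sites is the canonical one on the index bonds
  obtain rfl : inst = (inferInstance : Fintype (BondIdx (domT i.hN i.D i.hk))) := Subsingleton.elim _ _
  have hMh := one_le_Mh i
  have hk1 := one_le_k i
  have hR1 : (1 : ℝ) ≤ (i.R : ℝ) - 1 := by
    have h : 2 * ((ℓ : ℝ) + 1) ^ 2 ≤ (i.R : ℝ) := by exact_mod_cast i.hR2
    nlinarith [(Nat.cast_nonneg ℓ : (0 : ℝ) ≤ ℓ)]
  have hMeq : (geo9K i).M = ((ℓ : ℝ) + 1) * (i.Mh : ℝ) := by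
    show (((ℓ + 1 : ℕ) : ℝ)) * (i.Mh : ℝ) = _
    push_cast; ring
  have hM' : (R₁ : ℝ) ≤ ((ℓ : ℝ) + 1) * (i.Mh : ℝ) := hMeq ▸ hM
  have hM0 : (0 : ℝ) ≤ ((ℓ : ℝ) + 1) * (i.Mh : ℝ) := by positivity
  -- print's (2.59) for `(R − 1)·M` at the member
  have h259 : B6.Cond259 (d + 1) δ₀ (1 / 2) ((geoTP (toKT i)).R - 1) (geoTP (toKT i)).M := by
    show B6.Cond259 (d + 1) δ₀ (1 / 2) ((i.R : ℝ) - 1) (((ℓ : ℝ) + 1) * (i.Mh : ℝ))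
    have h1 := hR₁ 1 le_rfl
    unfold B6.Cond259 at h1 ⊢
    rw [Nat.cast_one, mul_one] at h1
    refine lt_of_lt_of_le h1 ?_
    have hRM : (R₁ : ℝ) ≤ ((i.R : ℝ) - 1) * (((ℓ : ℝ) + 1) * (i.Mh : ℝ)) :=
      le_trans hM' (le_mul_of_one_le_left hM0 hR1)
    calc 1 / 4 * (1 / 2) * δ₀ * (R₁ : ℝ) = (1 / 4 * (1 / 2) * δ₀) * (R₁ : ℝ) := by ring
      _ ≤ (1 / 4 * (1 / 2) * δ₀) * (((i.R : ℝ) - 1) * (((ℓ : ℝ) + 1) * (i.Mh : ℝ))) :=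
          mul_le_mul_of_nonneg_left hRM (by positivity)
      _ = 1 / 4 * (1 / 2) * δ₀ * ((i.R : ℝ) - 1) * (((ℓ : ℝ) + 1) * (i.Mh : ℝ)) := by ring
  obtain ⟨-, h261⟩ := h21 (toKT i) trivial (1 / 2) hα0 hα1 h259
  -- (2.61) on the blocks of the torus at the rate ½δ₀, pulled back along `β` (fibres ≤ 2(d+1)); rate monotonicity ½δ₀ ≤ κ
  -- (adapted from `Node00.CarriersB6KDischarge.lemma21Param_tower`)
  set g : (geoTP (toKT i)).Site → ℝ :=
    fun z => Real.exp (-(1 / 2 * δ₀ * (geoTP (toKT i)).dist (β i.hN i.D i.hk y) z)) with hg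
  have hg0 : ∀ z, 0 ≤ g z := fun z => (Real.exp_pos _).le
  have hrow : ∑ z, g z ≤ c₁ (1 / 2) := h261 (β i.hN i.D i.hk y)
  have hrate : (1 / 2 : ℝ) * δ₀ ≤ κ := by linarith
  have key : ∑ b' : BondIdx (domT i.hN i.D i.hk),
      Real.exp (-(κ * (geoTP (toKT i)).dist (β i.hN i.D i.hk y) (β i.hN i.D i.hk b'))) ≤ 2 * ((d : ℝ) + 1) * c₁ (1 / 2) := by
    have h1 : ∑ b' : BondIdx (domT i.hN i.D i.hk),
        Real.exp (-(κ * (geoTP (toKT i)).dist (β i.hN i.D i.hk y) (β i.hN i.D i.hk b'))) ≤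
        ∑ b' : BondIdx (domT i.hN i.D i.hk), g (β i.hN i.D i.hk b') :=
      Finset.sum_le_sum fun b' _ => by
        have hdist : 0 ≤ (geoTP (toKT i)).dist (β i.hN i.D i.hk y) (β i.hN i.D i.hk b') := Nat.cast_nonneg _
        exact Real.exp_le_exp.mpr (neg_le_neg (mul_le_mul_of_nonneg_right hrate hdist))
    refine h1.trans ?_
    rw [Finset.sum_comp]
    calc ∑ z ∈ Finset.univ.image (β i.hN i.D i.hk),
          (Finset.univ.filter fun b' => β i.hN i.D i.hk b' = z).card • g z
        ≤ ∑ z ∈ Finset.univ.image (β i.hN i.D i.hk), (2 * ((d : ℝ) + 1)) * g z :=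
          Finset.sum_le_sum fun z _ => by
            rw [nsmul_eq_mul]
            refine mul_le_mul_of_nonneg_right ?_ (hg0 z)
            exact_mod_cast card_fiber_beta_le i.hN i.D i.hk hk1 z
      _ ≤ ∑ z, (2 * ((d : ℝ) + 1)) * g z :=
          Finset.sum_le_sum_of_subset_of_nonneg (Finset.subset_univ _) fun z _ _ => mul_nonneg (by positivity) (hg0 z)
      _ = 2 * ((d : ℝ) + 1) * ∑ z, g z := by rw [Finset.mul_sum]
      _ ≤ 2 * ((d : ℝ) + 1) * c₁ (1 / 2) := mul_le_mul_of_nonneg_left hrow (by positivity)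
  exact key

/-- ★ **`RowSum261 geo9K`** — [4] (2.61) with a generic constant, at every rate, under an M-threshold, on the k-level V1 family (any `Fintype`
instance on the sites). [cite: Balaban1984PropagatorsII, Lemma 2.1 (2.61) p.234 + (2.59) p.233] -/
theorem rowSum261_geo9K [inst : ∀ i : KIdx d ℓ hd hL b₀ b₁, Fintype (geo9K i).Site] :
    RowSum261 (geo9K (d := d) (ℓ := ℓ) (hd := hd) (hL := hL) (b₀ := b₀) (b₁ := b₁)) := by
  intro κ hκ
  obtain ⟨ML, C, h⟩ := rowSum_geo9K_core (d := d) (ℓ := ℓ) (hd := hd) (hL := hL) (b₀ := b₀) (b₁ := b₁) hκ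
  exact ⟨ML, C, fun i hM y => @h i (inst i) hM y⟩

end RowSumSec

/-! ## §4 At def-Y's members `geo9Y x = geo9K x.toKIdx`: the three record-geometry binders of the N06 knit -/

section Members

variable {Mstar : ℕ}

/-- ★ `DistOK (geo9Y x)` — the knit's binder `D349`. [cite: Balaban1984PropagatorsII, (2.46) p.231 + (2.54) p.233] -/
theorem distOK_geo9Y (x : MemberY d ℓ hd hL b₀ b₁ Mstar) : DistOK (geo9Y x) := distOK_geo9K x.toKIdx

/-- `d(y, y′) = d(y′, y)` at a member. [cite: Balaban1984PropagatorsII, (2.46) p.231, bookkeeping] -/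
theorem geo9Y_dist_comm (x : MemberY d ℓ hd hL b₀ b₁ Mstar) (y y' : (geo9Y x).Site) : (geo9Y x).dist y y' = (geo9Y x).dist y' y :=
  geo9K_dist_comm x.toKIdx y y'

/-- `d(y, y) = 0` at a member. [cite: Balaban1984PropagatorsII, (2.46) p.231, bookkeeping] -/
theorem geo9Y_dist_self (x : MemberY d ℓ hd hL b₀ b₁ Mstar) (y : (geo9Y x).Site) : (geo9Y x).dist y y = 0 :=
  geo9K_dist_self x.toKIdx y

/-- (2.54) at a member. [cite: Balaban1984PropagatorsII, (2.54) p.233] -/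
theorem geo9Y_dist_triangle (x : MemberY d ℓ hd hL b₀ b₁ Mstar) (a b c : (geo9Y x).Site) :
    (geo9Y x).dist a c ≤ (geo9Y x).dist a b + (geo9Y x).dist b c :=
  geo9K_dist_triangle x.toKIdx a b c

/-- `0 < L^jη` at a member. [cite: Balaban1985BackgroundPropagators, (3.41) p.397 («Lʲη»), bookkeeping] -/
theorem geo9Y_len_pos (x : MemberY d ℓ hd hL b₀ b₁ Mstar) (y : (geo9Y x).Site) : 0 < (geo9Y x).len y :=
  geo9K_len_pos x.toKIdx y

/-- ★ `LevelGap geo9Y R₀` for every `R₀ ≤ 2L² − 1` — the knit's binder `hgap`. [cite: Balaban1984PropagatorsII, Lemma 2.1 (2.60) p.234, (2.2) p.224] -/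
theorem levelGap_geo9Y {R₀ : ℝ} (hR₀ : R₀ ≤ 2 * ((ℓ : ℝ) + 1) ^ 2 - 1) :
    LevelGap (geo9Y (d := d) (ℓ := ℓ) (hd := hd) (hL := hL) (b₀ := b₀) (b₁ := b₁) (Mstar := Mstar)) R₀ :=
  fun x y y' => levelGap_geo9K hR₀ x.toKIdx y y'

/-- `LevelGap geo9Y 1` (so `hR₀ : 0 < 1`). [cite: Balaban1984PropagatorsII, Lemma 2.1 (2.60) p.234] -/
theorem levelGap_geo9Y_one : LevelGap (geo9Y (d := d) (ℓ := ℓ) (hd := hd) (hL := hL) (b₀ := b₀) (b₁ := b₁) (Mstar := Mstar)) 1 :=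
  fun x y y' => levelGap_geo9K_one x.toKIdx y y'

/-- ★ `RowSum261 geo9Y` (any `Fintype` instance on the sites, as the knit binds it) — the knit's binder `h261row`.
[cite: Balaban1984PropagatorsII, Lemma 2.1 (2.61) p.234 + (2.59) p.233] -/
theorem rowSum261_geo9Y [instY : ∀ x : MemberY d ℓ hd hL b₀ b₁ Mstar, Fintype (geo9Y x).Site] :
    RowSum261 (geo9Y (d := d) (ℓ := ℓ) (hd := hd) (hL := hL) (b₀ := b₀) (b₁ := b₁) (Mstar := Mstar)) := by
  intro κ hκ
  obtain ⟨ML, C, h⟩ := rowSum_geo9K_core (d := d) (ℓ := ℓ) (hd := hd) (hL := hL) (b₀ := b₀) (b₁ := b₁) hκ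
  exact ⟨ML, C, fun x hM y => @h x.toKIdx (instY x) hM y⟩

end Members

/-! ## §5 (v1.1) Row 26's weights transfer `hwt` at the record geometry, for the SYMMETRIC normalisation
`B9Eq3132Whole.stmt3132Printed_of_coercive` (row 26) takes `hwt : ∀ ε > 0, ∃ M_w, ∀ i, M_w ≤ M → WeightsTransfer (geo i) d′ (w i) ε A ∧ …`, displayed by the
N06 knit (`…ObligationsBatch2` :168) with the instance's weights.  For the SYMMETRIC weights `w(y) = (Lʲη)^{−(1+d′∕2)}` it is [4] (2.60) again:
`ineq260_geo9K` ⇒ `B6Cor28.transfer_of_260` (constant `L^{|q|}`, `q = (d′−2)∕2`, largeness `|q|·log L ≤ ε·(2L²−1)·M`) ⇒ `B9Eq3132Whole.weightsTransfer_symm_of_260`.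
Which normalisation def-Y's readings use is the instance's choice; this section discharges `hwt` for the symmetric one. -/

section WeightsSec
open B6Cor28 (TransferL transfer_of_260)
open B9Eq3132Whole (WeightsTransfer weightsTransfer_symm_of_260)

/-- the scale length of the reading as a real power: `Lʲη = L^{(j : ℝ)}·η`. [cite: Balaban1985BackgroundPropagators, (3.41) p.397 («Lʲη»), bookkeeping] -/
theorem geo9K_len_eq_rpow (i : KIdx d ℓ hd hL b₀ b₁) (y : (geo9K i).Site) :
    (geo9K i).len y = (geo9K i).L ^ ((geo9K i).scale y : ℝ) * (geo9K i).eta := by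
  rw [Real.rpow_natCast]; rfl

/-- `0 ≤ M = L·M_h`. [cite: Balaban1984PropagatorsII, (2.1)–(2.2) p.224, bookkeeping] -/
theorem geo9K_M_nonneg (i : KIdx d ℓ hd hL b₀ b₁) : 0 ≤ (geo9K i).M := by
  show (0 : ℝ) ≤ (((ℓ + 1 : ℕ) : ℝ)) * (i.Mh : ℝ); positivity

/-- **(2.60) ⇒ SCALE TRANSFER AT EVERY RATE `ε > 0` AND REAL POWER `q` UNDER AN M-THRESHOLD**: every member with `|q|·log L ≤ ε·(2L² − 1)·M` has
`(L^{j′}η)^q ≤ L^{|q|}·e^{εd(y,y′)}·(Lʲη)^q` for all `y, y′` (`B6Cor28.TransferL`), by `B6Cor28.transfer_of_260` on `ineq260_geo9K`.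
[cite: Balaban1984PropagatorsII, Lemma 2.1 (2.60) p.234 with (2.88) p.238] -/
theorem transferL_geo9K (i : KIdx d ℓ hd hL b₀ b₁) {ε : ℝ} (hε : 0 < ε) (q : ℝ)
    (hM : |q| * Real.log (geo9K i).L ≤ ε * (2 * ((ℓ : ℝ) + 1) ^ 2 - 1) * (geo9K i).M) :
    TransferL (geo9K i).len (geo9K i).dist ε q ((geo9K i).L ^ |q|) := by
  have hL0 : 0 < (geo9K i).L := lt_of_lt_of_le one_pos (geo9K_one_le_L i)
  have hlarge : (geo9K i).L ^ |q| ≤ Real.exp (ε * (2 * ((ℓ : ℝ) + 1) ^ 2 - 1) * (geo9K i).M) := by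
    rw [Real.rpow_def_of_pos hL0]
    exact Real.exp_le_exp.mpr ((mul_comm (Real.log (geo9K i).L) |q|).le.trans hM)
  have h := (transfer_of_260 (geo9K i).scale (geo9K i).dist (geo9K i).L (geo9K i).eta ε
    (2 * ((ℓ : ℝ) + 1) ^ 2 - 1) (geo9K i).M q (geo9K_one_le_L i) (geo9K_eta_pos i) hlarge (fun y y' => ineq260_geo9K i hε.le y y')).2
  rwa [show (fun y => (geo9K i).L ^ ((geo9K i).scale y : ℝ) * (geo9K i).eta) = (geo9K i).len from
    funext fun y => (geo9K_len_eq_rpow i y).symm] at h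

/-- ★ **ROW 26's `hwt` FOR THE SYMMETRIC NORMALISATION ON THE k-LEVEL V1 FAMILY**: for every `ε > 0` there is `M_w` (`= |q|·log L∕ε`, `q = (d′−2)∕2`) such
that every member with `M ≥ M_w` satisfies `WeightsTransfer (geo9K i) d′ (fun y => (Lʲη)^{−(1+d′∕2)}) ε L^{|q|}` — i.e. `w(y)w(y′) ≤ L^{|q|}e^{εd(y,y′)}(Lʲη)^{−2}(L^{j′}η)^{−d′}`.
[cite: Balaban1984PropagatorsII, Lemma 2.1 (2.60) p.234; Balaban1985BackgroundPropagators, (3.132) p.422 (the powers)] -/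
theorem weightsTransfer_symm_geo9K (dd : ℕ) {ε : ℝ} (hε : 0 < ε) :
    ∃ Mw : ℝ, ∀ i : KIdx d ℓ hd hL b₀ b₁, Mw ≤ (geo9K i).M →
      WeightsTransfer (geo9K i) dd (fun y => (geo9K i).len y ^ (-(1 + (dd : ℝ) / 2))) ε
        ((((ℓ + 1 : ℕ) : ℝ)) ^ |((dd : ℝ) - 2) / 2|) := by
  refine ⟨|((dd : ℝ) - 2) / 2| * Real.log (((ℓ + 1 : ℕ) : ℝ)) / ε, fun i hM => ?_⟩
  have hR1 : (1 : ℝ) ≤ 2 * ((ℓ : ℝ) + 1) ^ 2 - 1 := by nlinarith [(Nat.cast_nonneg ℓ : (0 : ℝ) ≤ ℓ)]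
  have hq : |((dd : ℝ) - 2) / 2| * Real.log (geo9K i).L ≤ ε * (2 * ((ℓ : ℝ) + 1) ^ 2 - 1) * (geo9K i).M :=
    calc |((dd : ℝ) - 2) / 2| * Real.log (geo9K i).L = |((dd : ℝ) - 2) / 2| * Real.log (((ℓ + 1 : ℕ) : ℝ)) := rfl
      _ ≤ (geo9K i).M * ε := (div_le_iff₀ hε).mp hM
      _ = ε * 1 * (geo9K i).M := by ring
      _ ≤ ε * (2 * ((ℓ : ℝ) + 1) ^ 2 - 1) * (geo9K i).M :=
          mul_le_mul_of_nonneg_right (mul_le_mul_of_nonneg_left hR1 hε.le) (geo9K_M_nonneg i)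
  exact weightsTransfer_symm_of_260 dd (geo9K_len_pos i) (transferL_geo9K i hε _ hq)

variable {Mstar : ℕ}

/-- ★ the same at def-Y's members `geo9Y x`. [cite: Balaban1984PropagatorsII, Lemma 2.1 (2.60) p.234; Balaban1985BackgroundPropagators, (3.132) p.422] -/
theorem weightsTransfer_symm_geo9Y (dd : ℕ) {ε : ℝ} (hε : 0 < ε) :
    ∃ Mw : ℝ, ∀ x : MemberY d ℓ hd hL b₀ b₁ Mstar, Mw ≤ (geo9Y x).M →
      WeightsTransfer (geo9Y x) dd (fun y => (geo9Y x).len y ^ (-(1 + (dd : ℝ) / 2))) ε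
        ((((ℓ + 1 : ℕ) : ℝ)) ^ |((dd : ℝ) - 2) / 2|) := by
  obtain ⟨Mw, h⟩ := weightsTransfer_symm_geo9K (d := d) (ℓ := ℓ) (hd := hd) (hL := hL) (b₀ := b₀) (b₁ := b₁) dd hε
  exact ⟨Mw, fun x hM => h x.toKIdx hM⟩

/-- ★ **THE KNIT's `hwt` BINDER IN ITS DISPLAYED SHAPE** (`…ObligationsBatch2` :168; both normalisation readings with the symmetric weights,
`A := L^{|(d′−2)∕2|}`). [cite: Balaban1984PropagatorsII, Lemma 2.1 (2.60) p.234; Balaban1985BackgroundPropagators, (3.132) p.422] -/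
theorem hwt_symm_geo9Y (dd : ℕ) :
    ∀ ε : ℝ, 0 < ε → ∃ Mw : ℝ, ∀ x : MemberY d ℓ hd hL b₀ b₁ Mstar, Mw ≤ (geo9Y x).M →
      WeightsTransfer (geo9Y x) dd (fun y => (geo9Y x).len y ^ (-(1 + (dd : ℝ) / 2))) ε ((((ℓ + 1 : ℕ) : ℝ)) ^ |((dd : ℝ) - 2) / 2|) ∧
        WeightsTransfer (geo9Y x) dd (fun y => (geo9Y x).len y ^ (-(1 + (dd : ℝ) / 2))) ε ((((ℓ + 1 : ℕ) : ℝ)) ^ |((dd : ℝ) - 2) / 2|) :=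
  fun _ hε => (weightsTransfer_symm_geo9Y (d := d) (ℓ := ℓ) (hd := hd) (hL := hL) (b₀ := b₀) (b₁ := b₁) (Mstar := Mstar) dd hε).imp
    fun _ h x hM => ⟨h x hM, h x hM⟩

/-- `0 < L^{|(d′−2)∕2|}` (the knit's `hA32`). [cite: Balaban1985BackgroundPropagators, (3.132) p.422, bookkeeping] -/
theorem symmA_pos (dd : ℕ) : 0 < (((ℓ + 1 : ℕ) : ℝ)) ^ |((dd : ℝ) - 2) / 2| :=
  Real.rpow_pos_of_pos (by positivity) _

end WeightsSec

end Literature.MathematicalPhysics.QuantumFieldTheory.Balaban1983to89.B9GeoLemma21KLevelV1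

end
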